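import Mathlib
import Literature.Analysis.FluidPDE.NSFourierAPriori
import Summits.NavierStokesRegularity.NavierStokesRegularity.Theses.FrozenSignCascade
import HarnessLib

/-!
# Crux `FrozenSignCascade.EnvelopeBound` (stmt-NavierStokesRegularity-1549), line `registered`
  (reshape r3), stub `stub_energyCancellation`: the energy pairing of the projected nonlinearity
  vanishes

Helper file for the crux item stmt-NavierStokesRegularity-1549 (`EnvelopeBound` of route
`FrozenSignCascade`); lands `--supports` that item.

**Statement (`stub_energyCancellation`).** For a coefficient field `v : ℝ³ → ℂ³` on frequency
space (`EuclideanSpace ℝ (Fin 3) → Fin 3 → ℂ`) which is continuous, decays to every polynomial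
order (`HasDecay K A v` for every `K`), is divergence free on the Fourier side
(`∑ₗ ξₗ v(ξ)ₗ = 0`) and conjugation symmetric (`v(-ξ)ₗ = conj v(ξ)ₗ`, reality of the synthesized
velocity), the energy pairing of the Leray-projected nonlinearity
`N(v,v)(ξ)ₗ = -2πi ∑ⱼₖ m_{jkl}(ξ) (vⱼ ⋆ vₖ)(ξ)` vanishes:
`∫ ∑ₗ Re(conj(v(ξ)ₗ) N(v,v)(ξ)ₗ) dξ = 0` — the Fourier form of `∫ u·ℙ[(u·∇)u] dx = 0`
(Leray 1934, §19; Lemarié-Rieusset 2016, §6.1 and Thm. 7.2). The skeleton of the line turns it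
into the energy identity `E(t) + 2c ∫ₛᵗ Ens = E(s)` along Fourier-side mild solutions.

**Proof.**
1. *Projector* (`sum_conj_mul_lerayDerivSymbol`, `sum_conj_mul_nonlin`): with
   `m_{jkl}(ξ) = ξⱼ(δₖₗ − ξₖξₗ/‖ξ‖²)` and `∑ₗ ξₗ conj(vₗ) = conj(∑ₗ ξₗ vₗ) = 0`, pointwise
   `∑ₗ conj(vₗ) Nₗ = -2πi ∑ₖ conj(vₖ) ∑ⱼ ξⱼ (vⱼ ⋆ vₖ)`.
2. *Frequency Leibniz rule* (`sum_coord_mul_fconv`): `ξⱼ (vⱼ ⋆ vₖ) = (ηⱼvⱼ) ⋆ vₖ + vⱼ ⋆ (ηⱼvₖ)`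
   (`coord_mul_fconv`) and `∑ⱼ (ηⱼvⱼ) ⋆ vₖ = (∑ⱼ ηⱼvⱼ) ⋆ vₖ = 0`, so
   `∑ⱼ ξⱼ (vⱼ ⋆ vₖ) = ∑ⱼ vⱼ ⋆ wⱼₖ`, `wⱼₖ = ηⱼ vₖ`.
3. *Transposition* (`integral_conj_mul_fconv`): for scalar `f, g, h` with `g(-ξ) = conj g(ξ)`,
   `∫ conj(f)(h ⋆ g) = ∫ h · conj(f ⋆ g)` (one Fubini and `g(ξ - ζ) = conj g(ζ - ξ)`).
4. *Reality* (`conj_sum_pairing`): with `Sⱼₖ = ∫ conj(vₖ)(vⱼ ⋆ wⱼₖ) = ∫ conj(vₖ)(wⱼₖ ⋆ vⱼ)`,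
   step 3 gives `conj Sⱼₖ = ∫ conj(wⱼₖ)(vₖ ⋆ vⱼ) = ∫ conj(vₖ) ζⱼ (vⱼ ⋆ vₖ)`, and summing over
   `j` with step 2 returns `∑ⱼ Sⱼₖ`; hence `Z = ∑ₖ∑ⱼ Sⱼₖ` is real.
5. The pairing is `∫ ∑ₗ conj(vₗ) Nₗ = -2πi · Z` (`integral_re`, `integral_const_mul`,
   `integral_finsetSum`), whose real part is `2π · Im Z = 0`.
All integrability comes from the decay of order `5 = 1 + 4`, `4 > card (Fin 3)`
(`HasDecay.integrable`, `integrable_coord_mul`, `integrable_fconv`, `Integrable.bdd_mul`,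
`Integrable.mul_prod`).
-/

noncomputable section

set_option linter.dupNamespace false -- nested layout Summit.<S>.<Sub>, Sub = S (D-0017)

open MeasureTheory Set Real Filter Topology Function
open scoped ComplexConjugate
open Literature.Analysis.FluidPDE Literature.Analysis.FluidPDE.FourierNS

namespace Summit.NavierStokesRegularity.NavierStokesRegularity.Theorems.EnvelopeBound.Leray

variable {ι : Type*} [Fintype ι]

/-- **The pairing of a conjugate coefficient with a convolution, transposed.** For continuous
scalar coefficient fields `f, g, h` on frequency space with `f, h` integrable, `g` bounded and
`g` conjugation symmetric (`g(-ξ) = conj g(ξ)`),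
`∫ conj(f(ξ)) (h ⋆ g)(ξ) dξ = ∫ h(ζ) conj((f ⋆ g)(ζ)) dζ`: one Fubini on
`(ξ, ζ) ↦ conj(f ξ) h(ζ) g(ξ - ζ)` (dominated by `‖g‖_∞ ‖f(ξ)‖ ‖h(ζ)‖`) and
`g(ξ - ζ) = conj g(ζ - ξ)`. -/
theorem integral_conj_mul_fconv {f g h : EuclideanSpace ℝ ι → ℂ}
    (hfc : Continuous f) (hgc : Continuous g) (hhc : Continuous h)
    (hfi : Integrable f) (hhi : Integrable h) {B : ℝ} (hgB : ∀ ξ, ‖g ξ‖ ≤ B)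
    (hg : ∀ ξ, g (-ξ) = conj (g ξ)) :
    ∫ ξ, conj (f ξ) * fconv h g ξ = ∫ ζ, h ζ * conj (fconv f g ζ) := by
  have hprod : Integrable (uncurry fun ξ ζ => conj (f ξ) * (h ζ * g (ξ - ζ)))
      ((volume : Measure (EuclideanSpace ℝ ι)).prod volume) := by
    refine ((hfi.norm.mul_prod hhi.norm).const_mul B).mono' ?_ (Eventually.of_forall fun p => ?_)
    · exact ((Complex.continuous_conj.comp (hfc.comp continuous_fst)).mul
        ((hhc.comp continuous_snd).mul
          (hgc.comp (continuous_fst.sub continuous_snd)))).aestronglyMeasurable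
    · simp only [uncurry_def]
      rw [norm_mul, norm_mul, Complex.norm_conj]
      calc ‖f p.1‖ * (‖h p.2‖ * ‖g (p.1 - p.2)‖) ≤ ‖f p.1‖ * (‖h p.2‖ * B) := by
            gcongr; exact hgB _
        _ = B * (‖f p.1‖ * ‖h p.2‖) := by ring
  have hF : ∀ ξ, conj (f ξ) * fconv h g ξ = ∫ ζ, conj (f ξ) * (h ζ * g (ξ - ζ)) := fun ξ => by
    rw [fconv_apply, ← integral_const_mul]
  simp_rw [hF]
  rw [integral_integral_swap hprod]
  refine integral_congr_ae (Eventually.of_forall fun ζ => ?_)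
  simp only
  rw [fconv_apply, ← integral_conj, ← integral_const_mul]
  refine integral_congr_ae (Eventually.of_forall fun ξ => ?_)
  simp only
  rw [map_mul, ← hg, neg_sub]
  ring

/-- **Frequency Leibniz rule + incompressibility.** For a continuous divergence-free coefficient
field with decay of order `1 + K₀`, `K₀ > card ι`:
`∑ⱼ ξⱼ (vⱼ ⋆ vₖ)(ξ) = ∑ⱼ (vⱼ ⋆ (ηⱼvₖ))(ξ)` — by `coord_mul_fconv`,
`ξⱼ (vⱼ ⋆ vₖ) = (ηⱼvⱼ) ⋆ vₖ + vⱼ ⋆ (ηⱼvₖ)`, and `∑ⱼ (ηⱼvⱼ) ⋆ vₖ = (∑ⱼ ηⱼvⱼ) ⋆ vₖ = 0`. -/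
theorem sum_coord_mul_fconv {K₀ : ℕ} (hK₀ : Fintype.card ι < K₀) {A : ℝ}
    {v : EuclideanSpace ℝ ι → ι → ℂ} (hvc : Continuous v) (hv : HasDecay (1 + K₀) A v)
    (hdiv : ∀ ξ : EuclideanSpace ℝ ι, ∑ l, ((ξ l : ℝ) : ℂ) * v ξ l = 0)
    (ξ : EuclideanSpace ℝ ι) (k : ι) :
    ∑ j, ((ξ j : ℝ) : ℂ) * fconv (v · j) (v · k) ξ =
      ∑ j, fconv (v · j) (fun η => ((η j : ℝ) : ℂ) * v η k) ξ := by
  have hvm : AEStronglyMeasurable v volume := hvc.aestronglyMeasurable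
  have hv₀ : HasDecay K₀ A v := hv.of_le (by omega)
  have hA := hv.nonneg
  have hvj_int : ∀ j, Integrable (fun η => v η j) := fun j =>
    (hv₀.apply j).integrable (finrank_lt_of_card_lt hK₀) (aesm_apply hvm j)
  have hvj_bd : ∀ j η, ‖v η j‖ ≤ A := fun j η => (hv₀.apply j).norm_le η
  have hw_int : ∀ i j, Integrable (fun η : EuclideanSpace ℝ ι => ((η i : ℝ) : ℂ) * v η j) :=
    fun i j => integrable_coord_mul hK₀ hv hvm i j
  have hw_bd : ∀ i j (η : EuclideanSpace ℝ ι), ‖((η i : ℝ) : ℂ) * v η j‖ ≤ A := fun i j η => by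
    rw [norm_mul, Complex.norm_real, Real.norm_eq_abs]
    exact (abs_coord_mul_norm_le hv η i j).trans
      (mul_le_of_le_one_right hA (inv_one_add_norm_pow_le_one η K₀))
  have h₁ : ∀ j, Integrable fun η => ((η j : ℝ) : ℂ) * v η j * v (ξ - η) k := fun j =>
    (hw_int j j).mul_bdd ((((continuous_apply k).comp hvc).comp
      (continuous_const.sub continuous_id)).aestronglyMeasurable)
      (Eventually.of_forall fun η => hvj_bd k _)
  have h₂ : ∀ j, Integrable fun η => v η j * ((((ξ - η) j : ℝ) : ℂ) * v (ξ - η) k) := fun j =>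
    (hvj_int j).mul_bdd ((((continuous_coord_ofReal j).mul ((continuous_apply k).comp hvc)).comp
      (continuous_const.sub continuous_id)).aestronglyMeasurable)
      (Eventually.of_forall fun η => hw_bd j k _)
  have hLeib : ∀ j, ((ξ j : ℝ) : ℂ) * fconv (v · j) (v · k) ξ =
      fconv (fun η => ((η j : ℝ) : ℂ) * v η j) (v · k) ξ +
        fconv (v · j) (fun η => ((η j : ℝ) : ℂ) * v η k) ξ := fun j =>
    coord_mul_fconv j (h₁ j) (h₂ j)
  have hzero : ∑ j, fconv (fun η => ((η j : ℝ) : ℂ) * v η j) (v · k) ξ = 0 := by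
    simp only [fconv_apply]
    rw [← integral_finsetSum _ fun j _ => h₁ j]
    have h0 : ∀ η, ∑ j, ((η j : ℝ) : ℂ) * v η j * v (ξ - η) k = 0 := fun η => by
      rw [← Finset.sum_mul, hdiv η, zero_mul]
    simp only [h0, integral_zero]
  simp_rw [hLeib]
  rw [Finset.sum_add_distrib, hzero, zero_add]

/-- **The reduced trilinear pairing is real.** With `wⱼₖ = ηⱼ vₖ` and
`Sⱼₖ = ∫ conj(vₖ(ξ)) (vⱼ ⋆ wⱼₖ)(ξ) dξ`, `conj(∑ₖ∑ⱼ Sⱼₖ) = ∑ₖ∑ⱼ Sⱼₖ`: by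
`integral_conj_mul_fconv`, `conj Sⱼₖ = ∫ conj(wⱼₖ(ζ)) (vₖ ⋆ vⱼ)(ζ) dζ = ∫ conj(vₖ) ζⱼ (vⱼ ⋆ vₖ)`,
and summing over `j` with `sum_coord_mul_fconv` returns `∑ⱼ Sⱼₖ`. -/
theorem conj_sum_pairing {K₀ : ℕ} (hK₀ : Fintype.card ι < K₀) {A : ℝ}
    {v : EuclideanSpace ℝ ι → ι → ℂ} (hvc : Continuous v) (hv : HasDecay (1 + K₀) A v)
    (hdiv : ∀ ξ : EuclideanSpace ℝ ι, ∑ l, ((ξ l : ℝ) : ℂ) * v ξ l = 0)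
    (hsymm : ∀ (ξ : EuclideanSpace ℝ ι) (l : ι), v (-ξ) l = conj (v ξ l)) :
    conj (∑ k, ∑ j, ∫ ξ, conj (v ξ k) * fconv (v · j) (fun η => ((η j : ℝ) : ℂ) * v η k) ξ) =
      ∑ k, ∑ j, ∫ ξ, conj (v ξ k) * fconv (v · j) (fun η => ((η j : ℝ) : ℂ) * v η k) ξ := by
  have hvm : AEStronglyMeasurable v volume := hvc.aestronglyMeasurable
  have hv₀ : HasDecay K₀ A v := hv.of_le (by omega)
  have hvj_c : ∀ j, Continuous fun η => v η j := fun j => (continuous_apply j).comp hvc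
  have hvj_int : ∀ j, Integrable (fun η => v η j) := fun j =>
    (hv₀.apply j).integrable (finrank_lt_of_card_lt hK₀) (aesm_apply hvm j)
  have hvj_bd : ∀ j η, ‖v η j‖ ≤ A := fun j η => (hv₀.apply j).norm_le η
  have hw_c : ∀ j k, Continuous fun η : EuclideanSpace ℝ ι => ((η j : ℝ) : ℂ) * v η k :=
    fun j k => (continuous_coord_ofReal j).mul (hvj_c k)
  have hw_int : ∀ j k, Integrable (fun η : EuclideanSpace ℝ ι => ((η j : ℝ) : ℂ) * v η k) :=
    fun j k => integrable_coord_mul hK₀ hv hvm j k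
  have hconv_bd : ∀ j k ξ, ‖fconv (v · j) (v · k) ξ‖ ≤ A * ∫ η, ‖v η j‖ := fun j k ξ =>
    norm_fconv_le_mul_integral_norm (hvj_int j) (hvj_bd k) ξ
  have hS_int : ∀ j k, Integrable fun ξ =>
      conj (v ξ k) * fconv (v · j) (fun η => ((η j : ℝ) : ℂ) * v η k) ξ := fun j k =>
    (integrable_fconv (hvj_int j) (hw_int j k)).bdd_mul
      (Complex.continuous_conj.comp (hvj_c k)).aestronglyMeasurable
      (Eventually.of_forall fun ξ => by rw [Complex.norm_conj]; exact hvj_bd k ξ)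
  have hT_int : ∀ j k, Integrable fun ξ : EuclideanSpace ℝ ι =>
      conj (((ξ j : ℝ) : ℂ) * v ξ k) * fconv (v · k) (v · j) ξ := by
    intro j k
    refine ((hw_int j k).norm.mul_const (A * ∫ η, ‖v η k‖)).mono' ?_
      (Eventually.of_forall fun ξ => ?_)
    · exact (Complex.continuous_conj.comp (hw_c j k)).aestronglyMeasurable.mul
        (aestronglyMeasurable_fconv (hvj_int k) (hvj_int j))
    · rw [norm_mul, Complex.norm_conj]
      exact mul_le_mul_of_nonneg_left (hconv_bd k j ξ) (norm_nonneg _)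
  rw [map_sum]
  refine Finset.sum_congr rfl fun k _ => ?_
  rw [map_sum]
  have h1 : ∀ j, conj (∫ ξ, conj (v ξ k) * fconv (v · j) (fun η => ((η j : ℝ) : ℂ) * v η k) ξ) =
      ∫ ζ, conj (((ζ j : ℝ) : ℂ) * v ζ k) * fconv (v · k) (v · j) ζ := by
    intro j
    have hc : (∫ ξ, conj (v ξ k) * fconv (v · j) (fun η => ((η j : ℝ) : ℂ) * v η k) ξ) =
        ∫ ξ, conj (v ξ k) * fconv (fun η => ((η j : ℝ) : ℂ) * v η k) (v · j) ξ :=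
      integral_congr_ae (Eventually.of_forall fun ξ => by beta_reduce; rw [fconv_comm])
    rw [hc, integral_conj_mul_fconv (hvj_c k) (hvj_c j) (hw_c j k) (hvj_int k) (hw_int j k)
      (hvj_bd j) (fun ξ => hsymm ξ j), ← integral_conj]
    refine integral_congr_ae (Eventually.of_forall fun ζ => ?_)
    simp only [map_mul, Complex.conj_conj]
  simp_rw [h1]
  rw [← integral_finsetSum _ fun j _ => hT_int j k, ← integral_finsetSum _ fun j _ => hS_int j k]
  refine integral_congr_ae (Eventually.of_forall fun ζ => ?_)
  simp only
  calc ∑ j, conj (((ζ j : ℝ) : ℂ) * v ζ k) * fconv (v · k) (v · j) ζ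
      = conj (v ζ k) * ∑ j, ((ζ j : ℝ) : ℂ) * fconv (v · j) (v · k) ζ := by
        rw [Finset.mul_sum]
        refine Finset.sum_congr rfl fun j _ => ?_
        rw [map_mul, Complex.conj_ofReal, fconv_comm (v · k) (v · j)]
        ring
    _ = conj (v ζ k) * ∑ j, fconv (v · j) (fun η => ((η j : ℝ) : ℂ) * v η k) ζ := by
        rw [sum_coord_mul_fconv hK₀ hvc hv hdiv ζ k]
    _ = ∑ j, conj (v ζ k) * fconv (v · j) (fun η => ((η j : ℝ) : ℂ) * v η k) ζ :=
        Finset.mul_sum _ _ _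

variable [DecidableEq ι]

/-- **The projector pairs to zero with a divergence-free conjugate.** If `∑ₗ ξₗ v(ξ)ₗ = 0` then
`∑ₗ conj(v(ξ)ₗ) m_{jkl}(ξ) = ξⱼ conj(v(ξ)ₖ)`: in `m_{jkl}(ξ) = ξⱼ(δₖₗ − ξₖξₗ/‖ξ‖²)` the second
part multiplies `∑ₗ ξₗ conj(v(ξ)ₗ) = conj(∑ₗ ξₗ v(ξ)ₗ) = 0`. -/
theorem sum_conj_mul_lerayDerivSymbol {v : EuclideanSpace ℝ ι → ι → ℂ} {ξ : EuclideanSpace ℝ ι}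
    (hdiv : ∑ l, ((ξ l : ℝ) : ℂ) * v ξ l = 0) (j k : ι) :
    ∑ l, conj (v ξ l) * (lerayDerivSymbol j k l ξ : ℂ) = ((ξ j : ℝ) : ℂ) * conj (v ξ k) := by
  have hdiv' : ∑ l, ((ξ l : ℝ) : ℂ) * conj (v ξ l) = 0 := by
    have h := congrArg conj hdiv
    simpa only [map_sum, map_mul, Complex.conj_ofReal, map_zero] using h
  have h1 : ∀ l, conj (v ξ l) * (lerayDerivSymbol j k l ξ : ℂ) =
      ((ξ j : ℝ) : ℂ) * (if k = l then conj (v ξ l) else 0) -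
        ((ξ j * ξ k / ‖ξ‖ ^ 2 : ℝ) : ℂ) * (((ξ l : ℝ) : ℂ) * conj (v ξ l)) := by
    intro l
    rw [lerayDerivSymbol_apply]
    split_ifs <;> push_cast <;> ring
  simp_rw [h1]
  rw [Finset.sum_sub_distrib, ← Finset.mul_sum, ← Finset.mul_sum, hdiv', Finset.sum_ite_eq]
  simp

/-- **The energy pairing, pointwise.** For a divergence-free coefficient field,
`∑ₗ conj(v(ξ)ₗ) N(v,v)(ξ)ₗ = -2πi ∑ₖ conj(v(ξ)ₖ) ∑ⱼ ξⱼ (vⱼ ⋆ vₖ)(ξ)`: the projector part of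
the symbol drops out (`sum_conj_mul_lerayDerivSymbol`). -/
theorem sum_conj_mul_nonlin {v : EuclideanSpace ℝ ι → ι → ℂ} {ξ : EuclideanSpace ℝ ι}
    (hdiv : ∑ l, ((ξ l : ℝ) : ℂ) * v ξ l = 0) :
    ∑ l, conj (v ξ l) * nonlin v v ξ l =
      -(2 * π * Complex.I) *
        ∑ k, conj (v ξ k) * ∑ j, ((ξ j : ℝ) : ℂ) * fconv (v · j) (v · k) ξ := by
  calc ∑ l, conj (v ξ l) * nonlin v v ξ l
      = -(2 * π * Complex.I) * ∑ j, ∑ k, (∑ l, conj (v ξ l) * (lerayDerivSymbol j k l ξ : ℂ)) *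
          fconv (v · j) (v · k) ξ := by
        simp only [nonlin_apply, Finset.mul_sum, Finset.sum_mul]
        rw [Finset.sum_comm]
        refine Finset.sum_congr rfl fun j _ => ?_
        rw [Finset.sum_comm]
        refine Finset.sum_congr rfl fun k _ => Finset.sum_congr rfl fun l _ => ?_
        ring
    _ = -(2 * π * Complex.I) * ∑ j, ∑ k, ((ξ j : ℝ) : ℂ) * conj (v ξ k) *
          fconv (v · j) (v · k) ξ := by
        simp_rw [sum_conj_mul_lerayDerivSymbol hdiv]
    _ = -(2 * π * Complex.I) *
          ∑ k, conj (v ξ k) * ∑ j, ((ξ j : ℝ) : ℂ) * fconv (v · j) (v · k) ξ := by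
        congr 1
        rw [Finset.sum_comm]
        refine Finset.sum_congr rfl fun k _ => ?_
        rw [Finset.mul_sum]
        refine Finset.sum_congr rfl fun j _ => ?_
        ring

/-- **stub `stub_energyCancellation` — the energy pairing of the projected nonlinearity
vanishes.** For a coefficient field `v : ℝ³ → ℂ³` on frequency space which is continuous,
decays to every polynomial order, is divergence free on the Fourier side (`∑ₗ ξₗ vₗ(ξ) = 0`) and
conjugation symmetric (`v(-ξ) = conj v(ξ)`), `∫ ∑ₗ Re(conj(vₗ(ξ)) N(v,v)(ξ)ₗ) dξ = 0` — the
Fourier form of `∫ u·ℙ[(u·∇)u] = 0` (Leray 1934, §19; Lemarié-Rieusset 2016, §6.1, Thm. 7.2).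
Proof: pointwise `∑ₗ conj(vₗ) Nₗ = -2πi ∑ₖ∑ⱼ conj(vₖ)(vⱼ ⋆ ηⱼvₖ)` (`sum_conj_mul_nonlin`,
`sum_coord_mul_fconv`); the integral of the double sum is real (`conj_sum_pairing`), so the
pairing `-2πi · (real)` has real part `0` (`integral_re`). -/
theorem stub_energyCancellation :
    ∀ (v : EuclideanSpace ℝ (Fin 3) → Fin 3 → ℂ), Continuous v →
      (∀ K : ℕ, ∃ A : ℝ, Literature.Analysis.FluidPDE.FourierNS.HasDecay K A v) →
      (∀ ξ : EuclideanSpace ℝ (Fin 3), ∑ l, ((ξ l : ℝ) : ℂ) * v ξ l = 0) →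
      (∀ (ξ : EuclideanSpace ℝ (Fin 3)) (l : Fin 3), v (-ξ) l = (starRingEnd ℂ) (v ξ l)) →
      ∫ ξ, ∑ l, ((starRingEnd ℂ) (v ξ l) *
        Literature.Analysis.FluidPDE.FourierNS.nonlin v v ξ l).re = 0 := by
  intro v hvc hdec hdiv hsymm
  have hK₀ : Fintype.card (Fin 3) < 4 := by simp
  obtain ⟨A, hA⟩ := hdec 5
  have hA' : HasDecay (1 + 4) A v := hA
  have hvm : AEStronglyMeasurable v volume := hvc.aestronglyMeasurable
  have hv₀ : HasDecay 4 A v := hA.of_le (by norm_num)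
  have hvj_c : ∀ j, Continuous fun η => v η j := fun j => (continuous_apply j).comp hvc
  have hvj_int : ∀ j, Integrable (fun η => v η j) := fun j =>
    (hv₀.apply j).integrable (finrank_lt_of_card_lt hK₀) (aesm_apply hvm j)
  have hvj_bd : ∀ j η, ‖v η j‖ ≤ A := fun j η => (hv₀.apply j).norm_le η
  have hw_int : ∀ j k, Integrable (fun η : EuclideanSpace ℝ (Fin 3) => ((η j : ℝ) : ℂ) * v η k) :=
    fun j k => integrable_coord_mul hK₀ hA' hvm j k
  have hS_int : ∀ j k, Integrable fun ξ =>
      conj (v ξ k) * fconv (v · j) (fun η => ((η j : ℝ) : ℂ) * v η k) ξ := fun j k =>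
    (integrable_fconv (hvj_int j) (hw_int j k)).bdd_mul
      (Complex.continuous_conj.comp (hvj_c k)).aestronglyMeasurable
      (Eventually.of_forall fun ξ => by rw [Complex.norm_conj]; exact hvj_bd k ξ)
  -- the pointwise reduction of the pairing
  have hpt : ∀ ξ, ∑ l, conj (v ξ l) * nonlin v v ξ l = -(2 * π * Complex.I) *
      ∑ k, ∑ j, conj (v ξ k) * fconv (v · j) (fun η => ((η j : ℝ) : ℂ) * v η k) ξ := by
    intro ξ
    rw [sum_conj_mul_nonlin (hdiv ξ)]
    congr 1
    refine Finset.sum_congr rfl fun k _ => ?_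
    rw [sum_coord_mul_fconv hK₀ hvc hA' hdiv ξ k, Finset.mul_sum]
  have hint : Integrable fun ξ => ∑ l, conj (v ξ l) * nonlin v v ξ l := by
    have : (fun ξ => ∑ l, conj (v ξ l) * nonlin v v ξ l) = fun ξ => -(2 * π * Complex.I) *
        ∑ k, ∑ j, conj (v ξ k) * fconv (v · j) (fun η => ((η j : ℝ) : ℂ) * v η k) ξ :=
      funext hpt
    rw [this]
    exact (integrable_finsetSum _ fun k _ =>
      integrable_finsetSum _ fun j _ => hS_int j k).const_mul _
  have hre : ∫ ξ, ∑ l, (conj (v ξ l) * nonlin v v ξ l).re =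
      (∫ ξ, ∑ l, conj (v ξ l) * nonlin v v ξ l).re := by
    simp_rw [← Complex.re_sum]
    have h := integral_re hint
    simpa only [RCLike.re_to_complex] using h
  have hZ : (∑ k, ∑ j, ∫ ξ, conj (v ξ k) *
      fconv (v · j) (fun η => ((η j : ℝ) : ℂ) * v η k) ξ).im = 0 :=
    Complex.conj_eq_iff_im.1 (conj_sum_pairing hK₀ hvc hA' hdiv hsymm)
  rw [hre, integral_congr_ae (Eventually.of_forall hpt), integral_const_mul,
    integral_finsetSum _ fun k _ => integrable_finsetSum _ fun j _ => hS_int j k]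
  have hinner : ∀ k, ∫ ξ, ∑ j, conj (v ξ k) * fconv (v · j) (fun η => ((η j : ℝ) : ℂ) * v η k) ξ =
      ∑ j, ∫ ξ, conj (v ξ k) * fconv (v · j) (fun η => ((η j : ℝ) : ℂ) * v η k) ξ := fun k =>
    integral_finsetSum _ fun j _ => hS_int j k
  simp_rw [hinner]
  rw [Complex.mul_re, hZ, mul_zero, sub_zero]
  simp

end Summit.NavierStokesRegularity.NavierStokesRegularity.Theorems.EnvelopeBound.Leray

end
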